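import Summits.ResolutionOfSingularities.ResolutionOfSingularities.Theorems.EquisingularLiftEquisingularLiftNatSubchainSupplierInvSLDefs
import Summits.ResolutionOfSingularities.ResolutionOfSingularities.Theorems.EquisingularLiftEquisingularLiftNatRegularOfSpecialFibre
import HarnessLib

/-!
(v2 2026-08-28T20:52Z: + §S2 — desk R49 ADDENDUM (P2) shapes: `LetterDatumWith`, `LettersNamed`, payload slot `PreLetterSlotWith`; v1 78b631c8e4541636 unchanged above §S2.)
# [OURS · L1 W4.5(b) · EL♮ / EL♮(3)] `TCPlus.PreLetterDatum(With)` — the PRE-LETTER SLOT's datum and its PROMOTION to `TCPlus.LetterDatum`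
# (WIDTH TABLE D5 «IMMATURE HOST (key letter)», row D5-4 (b): Theorems port authored by res-L1-w45b-idea-1 g27 for res-type-027's Defs8; 027 = the one writer/filer)

PORT of `Cruxes/EquisingularLiftNatThree/KeyPolynomialLettersR17Defs.lean` (sha16 cf31c12cf1dc7fa5, crux commit 35652817b5d7; both crit panels ✓) into the
Theorems namespace `…Cruxes.EquisingularLiftNat.Sections.TCPlus` next to `TCPlus.LetterDatum` (…NatSubchainSupplierInvSLDefs l.79).  Text identical up to the
namespace and this docstring; suggested module name `…Theorems.EquisingularLiftEquisingularLiftNatPreLetterDatum` (or inlined at the head of Defs8 —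
the filer decides; ONE writer).  OURS · counted 0 · AI-written, weaker than expert review · NOT a statement of any manuscript ([Hironaka2017] is a candidate
under adjudication; nothing of it is asserted) · EL♮(3) NOT proved.  Definitions + pure-logic / one-citation wrappers only (no `sorry`, no instance, no
notation; standard axioms).

WHAT (D5-0b v0 7af9d1fe76df3036 + 027's co-sign conditions (C1)–(C4) + desk R46).  The iso word of the named customer S10 carries a SINGULAR hypersurface
member (the key letter `M`, for S10 `M♮ = V(X²W + YZ(Y+Z))`) through the moves at which it is not yet regular («immature host»: the point step `P`
and the carrier/pair round `CAR`), and PROMOTES it to an ordinary letter once its strict transform is regular (stage 2).  The engines' letter currency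
`TCPlus.LetterDatum O P q Y G X σ jG L` demands (l-iii) `Scheme.IsRegular 𝓛.subscheme`; the pre-letter slot's datum is the same WITHOUT (l-iii):
* `TCPlus.PreLetterDatumWith … L 𝓛` := (l-i) reduced trace `𝓛.comap jG = 𝓘⟨closure L⟩` ∧ (l-ii) stalkwise principal ∧ (l-iv) off the generic point of `Y`
  ∧ (l-v) `V(𝓛) → Spec O` flat — for an EXPLICIT model `𝓛`;  `TCPlus.PreLetterDatum` := `∃ 𝓛, PreLetterDatumWith … 𝓛`;
* `TCPlus.PreLetterSlot … Mp` := the `Option`-guarded form (027 (C1)/(C4): `Mp : Option (Set G)`, clauses guarded by `Mp = some _`; `none` is a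
  SYNTACTIC fixed point: `preLetterSlot_none`), with `preLetterSlot_some_iff`;
* `preLetterDatum_of_letterDatum` (forget (l-iii));  `letterDatum_of_preLetterDatumWith_of_isRegular` (re-insert it);
* PROMOTION `letterDatum_of_preLetterDatumWith_of_forall_over_closedPoint` (= D5-0b clause (iii) «PROMOTE, no blow-up»): if `V(𝓛)` is universally
  closed over `Spec O` (e.g. `X` proper over `O`) and the quotient stalks `𝒪_{X,x}/𝓛_x` are regular at every point of `supp 𝓛` over the closed point
  of `O`, the pre-letter IS a letter — one citation of `Scheme.isRegular_subscheme_of_forall_over_closedPoint` (…NatRegularOfSpecialFibre);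
  `forall_letterDatum_of_preLetterDatumWith` = the list form `∀ L ∈ Ls, …` that `TCPlus.MemberSL` consumes.
The special-point regularity is what T-M1-EXACT (`map_blowupAlgebraMap_strictTransformIdeal_eq`, …NatEquimultipleStrictTransform ✓ p515745) +
`isRegularLocalRing_quotient_of_reduction_notMem_sq` deliver chartwise once the downstairs strict transform `St²M` is regular; per customer the
certificates are ring identities cited BY NAME (S10 / `M♮`: `keyNat_promotable_E1y`, `keyNat_promotable_E1z`, `keyNat_total_CAR_Sy_E1x` of
`Cruxes/EquisingularLiftNatThree/KeyPolynomialLettersR18.lean`).  The equimultiplicity number and certificate of each immature step are inputs OF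
THE STEP's clause (027 (C4)), not fields of the datum.  Nothing here is a theorem about resolution.
-/

set_option linter.dupNamespace false -- mandated namespace of this single-conjunct summit

noncomputable section

open CategoryTheory CategoryTheory.Limits AlgebraicGeometry TopologicalSpace Topology IsLocalRing
open Literature.AlgebraicGeometry.Resolution
open AlgebraicGeometry.Scheme.IdealSheafData

namespace Summit.ResolutionOfSingularities.ResolutionOfSingularities.Cruxes.EquisingularLiftNat.Sections.TCPlus

variable (O : Type) [CommRing O] (P : Scheme.{0}) (q : P ⟶ Spec (.of O)) (Y : Set P)

/-- **`TCPlus.PreLetterDatumWith`** — clauses (l-i), (l-ii), (l-iv), (l-v) of `TCPlus.LetterDatum` for an EXPLICIT model `𝓛` (no regularity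
clause). [OURS · L1 W4.5b · D5-4 (b); source crux-idea toric-towers R17 Δ1] -/
def PreLetterDatumWith (G X : Scheme.{0}) (σ : X ⟶ P) (jG : G ⟶ X) (L : Set G) (𝓛 : X.IdealSheafData) : Prop :=
  𝓛.comap jG = vanishingIdeal (⟨closure L, isClosed_closure⟩ : Closeds G) ∧
    (∀ z : X, (stalkIdeal 𝓛 z).IsPrincipal) ∧
    σ '' (𝓛.support : Set X) ⊆ {y : P | ¬ IsGenericPoint y Y} ∧
    Flat (𝓛.subschemeι ≫ σ ≫ q)

/-- **`TCPlus.PreLetterDatum`** — `TCPlus.LetterDatum` without (l-iii): SOME model with reduced trace, stalkwise principal, off the generic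
point of `Y`, `O`-flat. [OURS · L1 W4.5b · D5-4 (b)] -/
def PreLetterDatum (G X : Scheme.{0}) (σ : X ⟶ P) (jG : G ⟶ X) (L : Set G) : Prop :=
  ∃ 𝓛 : X.IdealSheafData, PreLetterDatumWith O P q Y G X σ jG L 𝓛

/-- **`TCPlus.PreLetterSlot`** — the `Option`-guarded pre-letter slot of the widened state (027 (C1)/(C4)): `none` carries nothing, `some M`
carries `PreLetterDatum … M`. [OURS · L1 W4.5b · D5-4 (b)] -/
def PreLetterSlot (G X : Scheme.{0}) (σ : X ⟶ P) (jG : G ⟶ X) (Mp : Option (Set G)) : Prop :=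
  ∀ M : Set G, Mp = some M → PreLetterDatum O P q Y G X σ jG M

variable {O P q Y}

/-- The empty slot is a syntactic fixed point: `PreLetterSlot … none` holds outright (the inclusion `P ⊆ P⁶` runs `Mp := none`). [OURS · pure logic] -/
theorem preLetterSlot_none {G X : Scheme.{0}} {σ : X ⟶ P} {jG : G ⟶ X} : PreLetterSlot O P q Y G X σ jG none :=
  fun _ h => absurd h (Option.some_ne_none _).symm

/-- The filled slot is exactly one pre-letter datum. [OURS · pure logic] -/
theorem preLetterSlot_some_iff {G X : Scheme.{0}} {σ : X ⟶ P} {jG : G ⟶ X} {M : Set G} :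
    PreLetterSlot O P q Y G X σ jG (some M) ↔ PreLetterDatum O P q Y G X σ jG M :=
  ⟨fun h => h M rfl, fun h M' hM' => by cases hM'; exact h⟩

/-- A letter is a pre-letter (forget (l-iii)). [OURS · pure logic] -/
theorem preLetterDatum_of_letterDatum {G X : Scheme.{0}} {σ : X ⟶ P} {jG : G ⟶ X} {L : Set G}
    (h : LetterDatum O P q Y G X σ jG L) : PreLetterDatum O P q Y G X σ jG L := by
  obtain ⟨𝓛, h1, h2, -, h4, h5⟩ := h
  exact ⟨𝓛, h1, h2, h4, h5⟩

/-- A pre-letter whose explicit model is regular is a letter (re-insert (l-iii)). [OURS · pure logic] -/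
theorem letterDatum_of_preLetterDatumWith_of_isRegular {G X : Scheme.{0}} {σ : X ⟶ P} {jG : G ⟶ X} {L : Set G}
    {𝓛 : X.IdealSheafData} (h : PreLetterDatumWith O P q Y G X σ jG L 𝓛) (hreg : Scheme.IsRegular 𝓛.subscheme) :
    LetterDatum O P q Y G X σ jG L := by
  obtain ⟨h1, h2, h4, h5⟩ := h
  exact ⟨𝓛, h1, h2, hreg, h4, h5⟩

/-- **PROMOTION (D5-0b clause (iii)).** A pre-letter whose model `V(𝓛)` is universally closed over `Spec O` and whose quotient stalks
`𝒪_{X,x} ⧸ 𝓛_x` are regular local rings at every point of `supp 𝓛` over the closed point of `O` is a LETTER: `V(𝓛)` is regular by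
`Scheme.isRegular_subscheme_of_forall_over_closedPoint` (regular along the special fibre ⇒ regular: every point specialises to a special point,
and localisations of regular local rings are regular). [OURS · L1 W4.5b · D5-4 (b); one citation] -/
theorem letterDatum_of_preLetterDatumWith_of_forall_over_closedPoint [IsLocalRing O] {G X : Scheme.{0}} {σ : X ⟶ P} {jG : G ⟶ X}
    {L : Set G} {𝓛 : X.IdealSheafData} (h : PreLetterDatumWith O P q Y G X σ jG L 𝓛)
    [UniversallyClosed (𝓛.subschemeι ≫ σ ≫ q)]
    (hreg : ∀ x ∈ (𝓛.support : Set X), (σ ≫ q) x = closedPoint O →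
      IsRegularLocalRing (X.presheaf.stalk x ⧸ stalkIdeal 𝓛 x)) :
    LetterDatum O P q Y G X σ jG L :=
  letterDatum_of_preLetterDatumWith_of_isRegular h
    (Scheme.isRegular_subscheme_of_forall_over_closedPoint (σ ≫ q) 𝓛 hreg)

/-- The same for a WHOLE LIST of pre-letters sharing the stage (the shape `TCPlus.MemberSL` consumes: `∀ L ∈ Ls, LetterDatum …`).
[OURS · pure logic over the promotion] -/
theorem forall_letterDatum_of_preLetterDatumWith [IsLocalRing O] {G X : Scheme.{0}} {σ : X ⟶ P} {jG : G ⟶ X} {Ls : List (Set G)}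
    (𝓛 : Set G → X.IdealSheafData) (h : ∀ L ∈ Ls, PreLetterDatumWith O P q Y G X σ jG L (𝓛 L))
    (huc : ∀ L ∈ Ls, UniversallyClosed ((𝓛 L).subschemeι ≫ σ ≫ q))
    (hreg : ∀ L ∈ Ls, ∀ x ∈ ((𝓛 L).support : Set X), (σ ≫ q) x = closedPoint O →
      IsRegularLocalRing (X.presheaf.stalk x ⧸ stalkIdeal (𝓛 L) x)) :
    ∀ L ∈ Ls, LetterDatum O P q Y G X σ jG L := fun L hL =>
  haveI := huc L hL
  letterDatum_of_preLetterDatumWith_of_forall_over_closedPoint (h L hL) (hreg L hL)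

/-- **PROMOTE as a state move (D5-0b (iii) shape):** a filled slot `some M` whose datum promotes yields the letter, so the slot can be emptied and
`M` adjoined to the mature list: `(∀ L ∈ Ls, LetterDatum … L) → LetterDatum … M → ∀ L ∈ M :: Ls, LetterDatum … L`. [OURS · pure logic] -/
theorem forall_letterDatum_cons {G X : Scheme.{0}} {σ : X ⟶ P} {jG : G ⟶ X} {Ls : List (Set G)} {M : Set G}
    (hLs : ∀ L ∈ Ls, LetterDatum O P q Y G X σ jG L) (hM : LetterDatum O P q Y G X σ jG M) :
    ∀ L ∈ M :: Ls, LetterDatum O P q Y G X σ jG L := fun L hL => by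
  rcases List.mem_cons.mp hL with rfl | h
  · exact hM
  · exact hLs L h


/-! ## §S2 (v2, desk R49 ADDENDUM (P2), 2026-08-28T20:45:49Z) EXPLICIT-MODEL LETTERS, JOINT NAMING, AND THE PAYLOAD SLOT
(P2): «the upstairs invariant names the letters' models JOINTLY under ONE existential
(`∃ … (𝓛 : …), (∀ L ∈ Ls, LetterDatumWith (𝓛 L) L) ∧ (Mp = some M → PreLetterDatumWith 𝓜 M ∧ Inc …)`) and the key letter's DOWNSTAIRS slot carries its
KEY-FORM PRESENTATION `G`» — typed here as shapes 027 may inline: `LetterDatumWith` (the tree's `TCPlus.LetterDatum` with the model explicit),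
`LettersNamed Ls 𝓛`, and `PreLetterSlotWith carrier cert 𝓜 Mp` over an arbitrary payload type `α` (e.g. `α := Set G × MvPolynomial (Fin (n+1)) k`:
the set and its key form), `cert a 𝓜` = the carried syntactic certificate («`G ∈ 𝔞`») and/or the upstairs incidence `Inc`. All pure logic. -/

variable (O P q Y) in
/-- **`TCPlus.LetterDatumWith`** — `TCPlus.LetterDatum` (…NatSubchainSupplierInvSLDefs l.79) for an EXPLICIT model `𝓛`: (l-i)–(l-v) verbatim.
[OURS · L1 W4.5b · D5 (P2) shape] -/
def LetterDatumWith (G X : Scheme.{0}) (σ : X ⟶ P) (jG : G ⟶ X) (L : Set G) (𝓛 : X.IdealSheafData) : Prop :=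
  𝓛.comap jG = vanishingIdeal (⟨closure L, isClosed_closure⟩ : Closeds G) ∧
    (∀ z : X, (stalkIdeal 𝓛 z).IsPrincipal) ∧ Scheme.IsRegular 𝓛.subscheme ∧
    σ '' (𝓛.support : Set X) ⊆ {y : P | ¬ IsGenericPoint y Y} ∧
    Flat (𝓛.subschemeι ≫ σ ≫ q)

/-- `LetterDatum L ↔ ∃ 𝓛, LetterDatumWith L 𝓛` — definitionally. [OURS · pure logic] -/
theorem letterDatum_iff_exists_letterDatumWith {G X : Scheme.{0}} {σ : X ⟶ P} {jG : G ⟶ X} {L : Set G} :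
    LetterDatum O P q Y G X σ jG L ↔ ∃ 𝓛 : X.IdealSheafData, LetterDatumWith O P q Y G X σ jG L 𝓛 :=
  Iff.rfl

theorem letterDatum_of_letterDatumWith {G X : Scheme.{0}} {σ : X ⟶ P} {jG : G ⟶ X} {L : Set G} {𝓛 : X.IdealSheafData}
    (h : LetterDatumWith O P q Y G X σ jG L 𝓛) : LetterDatum O P q Y G X σ jG L :=
  ⟨𝓛, h⟩

/-- Forget (l-iii) with the model kept. [OURS · pure logic] -/
theorem preLetterDatumWith_of_letterDatumWith {G X : Scheme.{0}} {σ : X ⟶ P} {jG : G ⟶ X} {L : Set G} {𝓛 : X.IdealSheafData}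
    (h : LetterDatumWith O P q Y G X σ jG L 𝓛) : PreLetterDatumWith O P q Y G X σ jG L 𝓛 := by
  obtain ⟨h1, h2, -, h4, h5⟩ := h
  exact ⟨h1, h2, h4, h5⟩

/-- Re-insert (l-iii) with the model kept (PROMOTION lands in the named form). [OURS · pure logic] -/
theorem letterDatumWith_of_preLetterDatumWith_of_isRegular {G X : Scheme.{0}} {σ : X ⟶ P} {jG : G ⟶ X} {L : Set G}
    {𝓛 : X.IdealSheafData} (h : PreLetterDatumWith O P q Y G X σ jG L 𝓛) (hreg : Scheme.IsRegular 𝓛.subscheme) :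
    LetterDatumWith O P q Y G X σ jG L 𝓛 := by
  obtain ⟨h1, h2, h4, h5⟩ := h
  exact ⟨h1, h2, hreg, h4, h5⟩

variable (O P q Y) in
/-- **`TCPlus.LettersNamed … Ls 𝓛`** — the letters of the list with their models named JOINTLY by one function `𝓛 : Set G → X.IdealSheafData`
((P2)'s `∀ L ∈ Ls, LetterDatumWith (𝓛 L) L`). [OURS · D5 (P2) shape] -/
def LettersNamed (G X : Scheme.{0}) (σ : X ⟶ P) (jG : G ⟶ X) (Ls : List (Set G)) (𝓛 : Set G → X.IdealSheafData) : Prop :=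
  ∀ L ∈ Ls, LetterDatumWith O P q Y G X σ jG L (𝓛 L)

/-- Joint naming forgets to the engines' currency `∀ L ∈ Ls, LetterDatum … L` (`TCPlus.MemberSL`'s input). [OURS · pure logic] -/
theorem forall_letterDatum_of_lettersNamed {G X : Scheme.{0}} {σ : X ⟶ P} {jG : G ⟶ X} {Ls : List (Set G)}
    {𝓛 : Set G → X.IdealSheafData} (h : LettersNamed O P q Y G X σ jG Ls 𝓛) :
    ∀ L ∈ Ls, LetterDatum O P q Y G X σ jG L := fun L hL => ⟨𝓛 L, h L hL⟩

/-- Conversely the currency can be named jointly (choice; the junk model off the list is `⊤`). [OURS · pure logic] -/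
theorem exists_lettersNamed_of_forall_letterDatum {G X : Scheme.{0}} {σ : X ⟶ P} {jG : G ⟶ X} {Ls : List (Set G)}
    (h : ∀ L ∈ Ls, LetterDatum O P q Y G X σ jG L) :
    ∃ 𝓛 : Set G → X.IdealSheafData, LettersNamed O P q Y G X σ jG Ls 𝓛 := by
  classical
  refine ⟨fun L => if hL : L ∈ Ls then (h L hL).choose else ⊤, fun L hL => ?_⟩
  simp only [dif_pos hL]
  exact (h L hL).choose_spec

/-- `LettersNamed` at the empty list holds for any naming. [OURS · pure logic] -/
theorem lettersNamed_nil {G X : Scheme.{0}} {σ : X ⟶ P} {jG : G ⟶ X} (𝓛 : Set G → X.IdealSheafData) :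
    LettersNamed O P q Y G X σ jG [] 𝓛 := fun _ h => absurd h List.not_mem_nil

variable (O P q Y) in
/-- **`TCPlus.PreLetterSlotWith carrier cert 𝓜 Mp`** — the PAYLOAD form of the pre-letter slot ((P2)/(C4)): `Mp : Option α` for an arbitrary payload
type `α` packaging the pre-letter's set `carrier a` with whatever is carried downstairs (its key-form presentation), `𝓜` the model named jointly with
the letters', `cert a 𝓜 : Prop` the carried certificate (syntactic «`G ∈ 𝔞`», upstairs incidence `Inc`, …).  `none` carries nothing. [OURS · D5 (P2) shape] -/
def PreLetterSlotWith {α : Type} (G X : Scheme.{0}) (σ : X ⟶ P) (jG : G ⟶ X) (carrier : α → Set G)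
    (cert : α → X.IdealSheafData → Prop) (𝓜 : X.IdealSheafData) (Mp : Option α) : Prop :=
  ∀ a : α, Mp = some a → PreLetterDatumWith O P q Y G X σ jG (carrier a) 𝓜 ∧ cert a 𝓜

/-- The empty payload slot holds outright, for any model (C1: the inclusion `P ⊆ P⁶` runs `Mp := none`). [OURS · pure logic] -/
theorem preLetterSlotWith_none {α : Type} {G X : Scheme.{0}} {σ : X ⟶ P} {jG : G ⟶ X} {carrier : α → Set G}
    {cert : α → X.IdealSheafData → Prop} {𝓜 : X.IdealSheafData} : PreLetterSlotWith O P q Y G X σ jG carrier cert 𝓜 none :=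
  fun _ h => absurd h (Option.some_ne_none _).symm

/-- The filled payload slot is exactly the named pre-letter datum and its certificate. [OURS · pure logic] -/
theorem preLetterSlotWith_some_iff {α : Type} {G X : Scheme.{0}} {σ : X ⟶ P} {jG : G ⟶ X} {carrier : α → Set G}
    {cert : α → X.IdealSheafData → Prop} {𝓜 : X.IdealSheafData} {a : α} :
    PreLetterSlotWith O P q Y G X σ jG carrier cert 𝓜 (some a) ↔ PreLetterDatumWith O P q Y G X σ jG (carrier a) 𝓜 ∧ cert a 𝓜 :=
  ⟨fun h => h a rfl, fun h a' ha' => by cases ha'; exact h⟩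

/-- The payload slot forgets to the plain slot `PreLetterSlot … (Mp.map carrier)` (drop the model name and the certificate). [OURS · pure logic] -/
theorem preLetterSlot_of_preLetterSlotWith {α : Type} {G X : Scheme.{0}} {σ : X ⟶ P} {jG : G ⟶ X} {carrier : α → Set G}
    {cert : α → X.IdealSheafData → Prop} {𝓜 : X.IdealSheafData} {Mp : Option α}
    (h : PreLetterSlotWith O P q Y G X σ jG carrier cert 𝓜 Mp) : PreLetterSlot O P q Y G X σ jG (Mp.map carrier) := by
  intro M hM
  cases Mp with
  | none => exact absurd hM (by simp)
  | some a =>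
    simp only [Option.map_some, Option.some.injEq] at hM
    subst hM
    exact ⟨𝓜, (h a rfl).1⟩

/-- PROMOTION in the payload form: a filled payload slot whose model is regular yields the LETTER, named by the same model. [OURS · pure logic] -/
theorem letterDatumWith_of_preLetterSlotWith_some {α : Type} {G X : Scheme.{0}} {σ : X ⟶ P} {jG : G ⟶ X} {carrier : α → Set G}
    {cert : α → X.IdealSheafData → Prop} {𝓜 : X.IdealSheafData} {a : α}
    (h : PreLetterSlotWith O P q Y G X σ jG carrier cert 𝓜 (some a)) (hreg : Scheme.IsRegular 𝓜.subscheme) :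
    LetterDatumWith O P q Y G X σ jG (carrier a) 𝓜 :=
  letterDatumWith_of_preLetterDatumWith_of_isRegular (h a rfl).1 hreg

/-- … and the promoted letter JOINS the named list: `LettersNamed (Ls ++ [carrier a]) (Function.update 𝓛 (carrier a) 𝓜)` provided the new set is not
already a member (else the update would rename an old letter). [OURS · pure logic] -/
theorem lettersNamed_append_of_preLetterSlotWith_some {α : Type} {G X : Scheme.{0}} {σ : X ⟶ P} {jG : G ⟶ X} {carrier : α → Set G}
    {cert : α → X.IdealSheafData → Prop} {𝓜 : X.IdealSheafData} {a : α} {Ls : List (Set G)} {𝓛 : Set G → X.IdealSheafData}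
    (hLs : LettersNamed O P q Y G X σ jG Ls 𝓛) (hnot : carrier a ∉ Ls)
    (h : PreLetterSlotWith O P q Y G X σ jG carrier cert 𝓜 (some a)) (hreg : Scheme.IsRegular 𝓜.subscheme) :
    LettersNamed O P q Y G X σ jG (Ls ++ [carrier a]) (Function.update 𝓛 (carrier a) 𝓜) := by
  classical
  intro L hL
  rcases List.mem_append.mp hL with hL | hL
  · have hne : L ≠ carrier a := fun he => hnot (he ▸ hL)
    rw [Function.update_of_ne hne]
    exact hLs L hL
  · have he : L = carrier a := by simpa using hL
    subst he
    rw [Function.update_self]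
    exact letterDatumWith_of_preLetterSlotWith_some h hreg

end Summit.ResolutionOfSingularities.ResolutionOfSingularities.Cruxes.EquisingularLiftNat.Sections.TCPlus

end
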